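import Summits.BirchSwinnertonDyer.BirchSwinnertonDyer.Theorems.ResidualThetaTransportAtTwoRlfSharpEigenLocal
import Summits.BirchSwinnertonDyer.BirchSwinnertonDyer.Theorems.ResidualThetaTransportAtTwoRlfPrimaryTorsionEigenFinite
import Summits.BirchSwinnertonDyer.BirchSwinnertonDyer.Theorems.ThetaPartnerAtTwoSignedTransportAtTwoLocalFactorDivisible
import HarnessLib

/-!
# Road T for item 23110, input H-FIN, part 2: the local factor `X_v = H¹(H ∩ I_v, E[p^∞])` is `p`-primary with FINITE `p`-torsion,
# hence every decomposition conjugation on it has only finitely many integers with an infinite eigenspace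

Route `ResidualThetaTransportAtTwo` (RTT, crux r201, stmt-BirchSwinnertonDyer-23110) / `ThetaPartnerAtTwo`; seat `prover-bsd-wall-tp2-p2x` g12 LEAD
(`--supports stmt-BirchSwinnertonDyer-23110`). THEOREMS ONLY (no definition, no named fact, no `sorry`); closes nothing.

Greenberg (LNM 1716, §4 p. 113): «`𝒫_E^{(v)}(F_∞)` is `Λ`-cotorsion if `v ∤ p`» — in the tree's GV currency at one place: the group
`X_v = discreteH1 (inertiaIn (ker κ) v) E[p^∞] ≅ H¹(I_{K_v}, E[p^∞])` (transport `α` of `…LocalFactorTransport`) is `p`-primary with finite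
`p`-torsion (`finite_torsionBy_continuousCohomology_one_absInertia`, residue characteristic `≠ p`), so by the pure-algebra count
(`PrimaryTorsionEigen.finite_setOf_infinite_eigenspace`) every additive endomorphism of it — in particular the conjugation by an element of
the decomposition group (`…RlfSharpEigenLocal`) — has only finitely many integers `w` with infinite eigenspace; and only finitely many
integers `u` have `u^N` in a given finite set (`N ≥ 1`).

* `localFactor_isPrimary_and_finite_torsion` — `X_v` is `p`-primary and `X_v[p]` is finite (κ cyclotomic, `v ∤ p`);
* `finite_setOf_infinite_eigenspace_localFactor` — for every `δ ∈ D_v`: `{w : ℤ | {x ∈ X_v : conj_δ x = w • x} infinite}` is finite;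
* `finite_setOf_pow_mem` — `{u : ℤ | u ^ N ∈ W}` is finite for `W` finite and `N ≥ 1`.

HONEST FRAMING: closes nothing; 23110 is NOT proved; BSD is not proved by any of this.
References: [GreenbergLNM1716] §4 p. 113; [GreenbergVatsal2000] §2 Prop. (2.4).
-/

-- the Theorems namespace of this sub repeats the summit name by design (D-0017 nested layout)
set_option linter.dupNamespace false

noncomputable section

open scoped Classical Pointwise AddSubgroup
open CategoryTheory Function Topology
open _root_.Subgroup
open NumberField IsDedekindDomain Field ValuativeRel
open Literature.NumberTheory.GaloisRepresentations Literature.AnabelianGeometry.AbsoluteAnabelian Literature.GroupTheory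
open Literature.NumberTheory.EllipticCurves Literature.NumberTheory.EllipticCurves.GreenbergSelmer
  Literature.NumberTheory.EllipticCurves.GreenbergVatsal2000 Literature.NumberTheory.EllipticCurves.Kobayashi2003
  Literature.NumberTheory.EllipticCurves.Rank1Residual
open Summit.BirchSwinnertonDyer.Rank1Residual.X11b.LocBridge Summit.BirchSwinnertonDyer.Rank1Residual.X2.GreenbergVatsalUnramifiedAway
  Summit.BirchSwinnertonDyer.Rank1Residual.X2.LocalInertiaTateQuotient
open Summit.BirchSwinnertonDyer.BirchSwinnertonDyer.Theorems.SignedTransportAtTwo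

namespace Summit.BirchSwinnertonDyer.BirchSwinnertonDyer.Theorems.SignedEC.SharpEigen

variable {K : Type} [Field K] [NumberField K] {p : ℕ} [Fact p.Prime] (κ : ZpExtension K p)
  (v : HeightOneSpectrum (𝓞 K)) (W : WeierstrassCurve K) [W.IsElliptic]

/-- **`X_v = H¹(H ∩ I_v, E[p^∞])` is `p`-primary with finite `p`-torsion** (κ cyclotomic, `v ∤ p`): transport along the additive
bijection `α : X_v ≅ H¹(I_{K_v}, E[p^∞])` (`exists_bijective_localFactor_iff_eventually_fixed`) of the corresponding facts for the inertia
cohomology of the local field (`p`-primary coefficients; `finite_torsionBy_continuousCohomology_one_absInertia`, residue characteristic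
`≠ p`, `E(K̄)` divisible). [cite: GreenbergLNM1716, §4 p. 113] [cite: GreenbergVatsal2000, §2 Prop. (2.4)] -/
theorem localFactor_isPrimary_and_finite_torsion (hκ : κ.IsCyclotomic) (hpv : ((p : ℕ) : 𝓞 K) ∉ v.asIdeal) :
    (∀ x : discreteH1 (inertiaIn κ.kerSubgroup v) (W.geomPrimaryTorsion p), ∃ k : ℕ, p ^ k • x = 0) ∧
      {x : discreteH1 (inertiaIn κ.kerSubgroup v) (W.geomPrimaryTorsion p) | p • x = 0}.Finite := by
  have hp : p.Prime := Fact.out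
  let F := v.adicCompletion K
  haveI : CharZero F := charZero_of_injective_algebraMap (algebraMap K F).injective
  haveI : CompactSpace (absoluteGaloisGroup F) := absoluteGaloisGroup_compactSpace F
  haveI : CompactSpace (absInertia F) := isCompact_iff_compactSpace.mp (isClosed_absInertia_holds F).isCompact
  obtain ⟨φ, hφ⟩ := exists_isFrobPow_holds (F := F) 1
  obtain ⟨α, hαbij, -⟩ := exists_bijective_localFactor_iff_eventually_fixed κ v W hκ hpv hφ
  let ρ : ContinuousRep (absoluteGaloisGroup F) ℤ (W.geomPrimaryTorsion p) :=
    (primaryGaloisModule W p).restrict (absGaloisRestrict K F)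
  have hℓ : ¬ ringChar 𝓀[F] ∣ p := not_ringChar_residueField_adicCompletion_dvd (w := v) hpv
  have htor : ∀ m : W.geomPrimaryTorsion p, ∃ k : ℕ, p ^ k • m = 0 := fun m ↦ by
    obtain ⟨k, hk⟩ := (AddCommGroup.mem_primaryComponent).1 m.2
    exact ⟨k, Subtype.ext (by rw [AddSubmonoidClass.coe_nsmul, ZeroMemClass.coe_zero]; exact hk)⟩
  -- `p`-primary: every class of `H¹(I_F, E[p^∞])` is `p`-power torsion, transported by the injective `α`
  have htorX : ∀ z : continuousCohomology 1 (subgroupRep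
      (((primaryGaloisModule W p).restrict (absGaloisRestrict K (v.adicCompletion K))).toTopRep)
      (absInertia (v.adicCompletion K))), ∃ k : ℕ, p ^ k • z = 0 := fun z ↦ by
    obtain ⟨N, hN⟩ := exists_prime_pow_smul_oneCocycleClass_eq_zero
      ((ρ.restrict (Literature.NumberTheory.GaloisRepresentations.subgroupIncl (absInertia F))).toTopRep) (p := p) htor z
    refine ⟨N, ?_⟩
    rw [Submodule.mem_torsionBy_iff, Nat.cast_smul_eq_nsmul] at hN
    exact hN
  refine ⟨fun x ↦ ?_, ?_⟩
  · obtain ⟨k, hk⟩ := htorX (α x)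
    refine ⟨k, hαbij.1 ?_⟩
    rw [map_nsmul, hk, map_zero]
  · -- finite `p`-torsion: `X_v[p] ↪ H¹(I_F, E[p^∞])[p]`, finite by `finite_torsionBy_continuousCohomology_one_absInertia`
    have hℓ' : (ringChar 𝓀[F]).Prime := ringChar_residueField_prime (F := F)
    have hcop : p.Coprime (ringChar 𝓀[F]) := (Nat.coprime_primes hp hℓ').2 fun h ↦ hℓ (by rw [h])
    have hdiv : ∀ m : W.geomPrimaryTorsion p, ∃ m' : W.geomPrimaryTorsion p, p • m' = m :=
      exists_nsmul_eq_geomPrimaryTorsion W p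
    haveI : Finite (Submodule.torsionBy ℤ (W.geomPrimaryTorsion p) ((p : ℕ) : ℤ)) := by
      haveI := W.finite_torsionBy_geomPrimaryTorsion p 1
      refine Finite.of_injective (fun a : Submodule.torsionBy ℤ (W.geomPrimaryTorsion p) ((p : ℕ) : ℤ) ↦
        (⟨(a : W.geomPrimaryTorsion p), ?_⟩ : (W.geomPrimaryTorsion p)[(p ^ 1 : ℕ)])) (fun a b hab ↦ Subtype.ext ?_)
      · have h1 : (((p : ℕ) : ℤ)) • (a : W.geomPrimaryTorsion p) = 0 := (Submodule.mem_torsionBy_iff _ _).1 a.2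
        rw [AddSubgroup.torsionBy, Submodule.mem_toAddSubgroup, Submodule.mem_torsionBy_iff, pow_one]
        exact h1
      · have := congrArg Subtype.val hab
        exact this
    haveI hF := finite_torsionBy_continuousCohomology_one_absInertia F ρ hcop hdiv
    have hfinT : Set.Finite {z : continuousCohomology 1 (subgroupRep
        (((primaryGaloisModule W p).restrict (absGaloisRestrict K (v.adicCompletion K))).toTopRep)
        (absInertia (v.adicCompletion K))) | p • z = 0} := by
      haveI : Finite {z : continuousCohomology 1 (subgroupRep
          (((primaryGaloisModule W p).restrict (absGaloisRestrict K (v.adicCompletion K))).toTopRep)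
          (absInertia (v.adicCompletion K))) | p • z = 0} := by
        refine Finite.of_injective (fun z : {z : continuousCohomology 1 (subgroupRep
            (((primaryGaloisModule W p).restrict (absGaloisRestrict K (v.adicCompletion K))).toTopRep)
            (absInertia (v.adicCompletion K))) | p • z = 0} ↦
          (⟨z.1, ?_⟩ : Submodule.torsionBy ℤ (continuousCohomology 1
            ((ρ.restrict (Literature.NumberTheory.GaloisRepresentations.subgroupIncl (absInertia F))).toTopRep)) ((p : ℕ) : ℤ)))
          (fun a b hab ↦ Subtype.ext ?_)
        · rw [Submodule.mem_torsionBy_iff, Nat.cast_smul_eq_nsmul]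
          exact z.2
        · have := congrArg Subtype.val hab
          exact this
      exact Set.toFinite _
    refine (hfinT.preimage hαbij.1.injOn).subset fun x hx ↦ ?_
    simp only [Set.mem_setOf_eq, Set.mem_preimage] at hx ⊢
    rw [← map_nsmul, hx, map_zero]

/-- **Only finitely many integers have an infinite eigenspace for a decomposition conjugation on `X_v`** (κ cyclotomic, `v ∤ p`,
`δ ∈ D_v`): the pure-algebra count `PrimaryTorsionEigen.finite_setOf_infinite_eigenspace` applied to the `p`-primary group `X_v` with
finite `p`-torsion and the endomorphism `conj_δ`. [cite: GreenbergLNM1716, §4 p. 113] -/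
theorem finite_setOf_infinite_eigenspace_localFactor (hκ : κ.IsCyclotomic) (hpv : ((p : ℕ) : 𝓞 K) ∉ v.asIdeal)
    (δ : decomp (K := K) v) :
    haveI := inertiaIn_normal κ.kerSubgroup v
    {w : ℤ | {x : discreteH1 (inertiaIn κ.kerSubgroup v) (W.geomPrimaryTorsion p) |
      Literature.NumberTheory.EllipticCurves.conjH1 (inertiaIn κ.kerSubgroup v) (W.geomPrimaryTorsion p) δ x = w • x}.Infinite}.Finite := by
  haveI := inertiaIn_normal κ.kerSubgroup v
  obtain ⟨htor, hfin⟩ := localFactor_isPrimary_and_finite_torsion κ v W hκ hpv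
  exact PrimaryTorsionEigen.finite_setOf_infinite_eigenspace (p := p)
    (Literature.NumberTheory.EllipticCurves.conjH1 (inertiaIn κ.kerSubgroup v) (W.geomPrimaryTorsion p) δ) htor hfin

omit [Fact p.Prime] in
/-- `{u : ℤ | u ^ N ∈ S}` is finite for `S` finite and `N ≥ 1` (`|u| ≤ |u| ^ N`). [folklore] -/
theorem finite_setOf_pow_mem {S : Set ℤ} (hS : S.Finite) {N : ℕ} (hN : 1 ≤ N) : {u : ℤ | u ^ N ∈ S}.Finite := by
  obtain ⟨B, hB⟩ : ∃ B : ℤ, ∀ s ∈ S, |s| ≤ B := by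
    obtain ⟨B, hB⟩ := (hS.image fun s ↦ |s|).bddAbove
    exact ⟨B, fun s hs ↦ hB (Set.mem_image_of_mem _ hs)⟩
  refine (Set.finite_Icc (-B) B).subset fun u hu ↦ ?_
  simp only [Set.mem_setOf_eq] at hu
  have h1 : |u| ≤ |u| ^ N := by
    rcases (abs_nonneg u).eq_or_lt with h0 | hpos
    · rw [← h0]; exact le_of_eq (by rw [zero_pow (by omega)])
    · have h1le : 1 ≤ |u| := by omega
      calc |u| = |u| ^ 1 := (pow_one _).symm
        _ ≤ |u| ^ N := pow_le_pow_right₀ h1le hN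
  have h2 : |u| ≤ B := by
    have h3 := hB _ hu
    rw [abs_pow] at h3
    exact h1.trans h3
  rw [Set.mem_Icc]
  exact abs_le.1 h2

end Summit.BirchSwinnertonDyer.BirchSwinnertonDyer.Theorems.SignedEC.SharpEigen

end
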